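import Summits.QuantumFields.YangMills.Theorems.ThermalDescentCornerCov

/-!
# Reflection symmetry and polarisation of the `Fin`-torus reflection covariance (support for
# `SqueezedSkewness.HighBallFloorsLPGlue`, stmt-QuantumFields-22797)

On the anisotropic `Fin`-torus `S³ × T` with Wilson's weight `w = e^{−βS}` and the normalised functional
`E[F] = (∫ F w)/Z`, for smeared plaquette fields `X_c(U) = Σ_x c(x) A_x(U)` and the time reflection `refl`
(tree `ThermalDescentReflection.reflFT`, an involution preserving `∏ dHaar` and Wilson's action):
`Cov(X_{c₁}∘refl, X_{c₂}) = Cov(X_{c₂}∘refl, X_{c₁})`, hence the POLARISATION identity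
`4·Cov(X_{c₁}∘refl, X_{c₂}) = Cov(X_{c₁+c₂}∘refl, X_{c₁+c₂}) − Cov(X_{c₁−c₂}∘refl, X_{c₁−c₂})`
(all observables are continuous on the compact configuration space, hence integrable).  The reflection is taken as an
argument `refl` with `refl U = reflFT U`, so that the route's literal `let refl` can be passed by `rfl`.
No definitions. [folklore] ([cite: OsterwalderSeilerAnnPhys1978, §2])
-/

noncomputable section

open scoped BigOperators
open MeasureTheory
open Literature.MathematicalPhysics.QuantumFieldTheory
open Summit.QuantumFields.YangMills.Theorems.ThermalDescentReflection

namespace Summit.QuantumFields.YangMills.Theorems.SqueezedSkewnessCovPolar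

variable {G : Type} [Group G] [TopologicalSpace G] [IsTopologicalGroup G] [CompactSpace G]
  [MeasurableSpace G] [BorelSpace G] [SecondCountableTopology G]
variable {N : ℕ} (ρ : G →* Matrix (Fin N) (Fin N) ℂ) (β : ℝ) {S T : ℕ} (Z : ℝ)

/-- Continuous functions on the (compact) configuration space are integrable for `∏ dHaar`. [folklore] -/
theorem integrable_of_continuous' {F : (FinTorusSite S S S T × Fin 4 → G) → ℝ} (hF : Continuous F) :
    Integrable F (Measure.pi fun _ : FinTorusSite S S S T × Fin 4 => haarProbability G) :=
  hF.integrable_of_hasCompactSupport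
    (IsCompact.of_isClosed_subset isCompact_univ (isClosed_tsupport _) (Set.subset_univ _))

/-- **POLARISATION OF THE REFLECTION COVARIANCE** for smeared plaquette fields on the `Fin`-torus. [folklore] -/
theorem cov_refl_polarisation (hρ : Continuous ρ)
    (refl : (FinTorusSite S S S T × Fin 4 → G) → (FinTorusSite S S S T × Fin 4 → G))
    (hrefl : ∀ U, refl U = reflFT U) (c₁ c₂ : FinTorusSite S S S T → ℝ) :
    let A : FinTorusSite S S S T → (FinTorusSite S S S T × Fin 4 → G) → ℝ := fun x U =>
      ∑ q : {q : Fin 4 × Fin 4 // q.1 < q.2}, (ρ (finTorusPlaquette U x q.1.1 q.1.2)).trace.re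
    let w : (FinTorusSite S S S T × Fin 4 → G) → ℝ := fun U => Real.exp (-β * ∑ x : FinTorusSite S S S T,
      ∑ q : {q : Fin 4 × Fin 4 // q.1 < q.2}, ((N : ℝ) - (ρ (finTorusPlaquette U x q.1.1 q.1.2)).trace.re))
    let E : ((FinTorusSite S S S T × Fin 4 → G) → ℝ) → ℝ := fun F =>
      (∫ U, F U * w U ∂Measure.pi fun _ : FinTorusSite S S S T × Fin 4 => haarProbability G) / Z
    let Cov : ((FinTorusSite S S S T × Fin 4 → G) → ℝ) → ((FinTorusSite S S S T × Fin 4 → G) → ℝ) → ℝ :=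
      fun F F' => E (fun U => F U * F' U) - E F * E F'
    let X : (FinTorusSite S S S T → ℝ) → (FinTorusSite S S S T × Fin 4 → G) → ℝ := fun c U =>
      ∑ x : FinTorusSite S S S T, c x * A x U
    4 * Cov (fun U => X c₁ (refl U)) (X c₂) =
      Cov (fun U => X (fun x => c₁ x + c₂ x) (refl U)) (X (fun x => c₁ x + c₂ x)) -
        Cov (fun U => X (fun x => c₁ x - c₂ x) (refl U)) (X (fun x => c₁ x - c₂ x)) := by
  dsimp only
  have hreflf : refl = reflFT := funext hrefl
  rw [hreflf]
  -- the four basic observables and the weight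
  set μH := (Measure.pi fun _ : FinTorusSite S S S T × Fin 4 => haarProbability G) with hμH
  set w : (FinTorusSite S S S T × Fin 4 → G) → ℝ := fun U => Real.exp (-β * ∑ x : FinTorusSite S S S T,
      ∑ q : {q : Fin 4 × Fin 4 // q.1 < q.2}, ((N : ℝ) - (ρ (finTorusPlaquette U x q.1.1 q.1.2)).trace.re)) with hw
  set X₁ : (FinTorusSite S S S T × Fin 4 → G) → ℝ := fun U => ∑ x : FinTorusSite S S S T,
      c₁ x * ∑ q : {q : Fin 4 × Fin 4 // q.1 < q.2}, (ρ (finTorusPlaquette U x q.1.1 q.1.2)).trace.re with hX₁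
  set X₂ : (FinTorusSite S S S T × Fin 4 → G) → ℝ := fun U => ∑ x : FinTorusSite S S S T,
      c₂ x * ∑ q : {q : Fin 4 × Fin 4 // q.1 < q.2}, (ρ (finTorusPlaquette U x q.1.1 q.1.2)).trace.re with hX₂
  have hXadd : ∀ U, (∑ x : FinTorusSite S S S T, (c₁ x + c₂ x) *
      ∑ q : {q : Fin 4 × Fin 4 // q.1 < q.2}, (ρ (finTorusPlaquette U x q.1.1 q.1.2)).trace.re) = X₁ U + X₂ U := by
    intro U; simp only [hX₁, hX₂, ← Finset.sum_add_distrib]; exact Finset.sum_congr rfl fun x _ => by ring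
  have hXsub : ∀ U, (∑ x : FinTorusSite S S S T, (c₁ x - c₂ x) *
      ∑ q : {q : Fin 4 × Fin 4 // q.1 < q.2}, (ρ (finTorusPlaquette U x q.1.1 q.1.2)).trace.re) = X₁ U - X₂ U := by
    intro U; simp only [hX₁, hX₂, ← Finset.sum_sub_distrib]; exact Finset.sum_congr rfl fun x _ => by ring
  simp_rw [hXadd, hXsub]
  -- continuity / integrability
  have hcw : Continuous w := continuous_weight (S := S) (T := T) ρ hρ β
  have hc1 : Continuous X₁ := continuous_smeared (S := S) (T := T) ρ hρ c₁
  have hc2 : Continuous X₂ := continuous_smeared (S := S) (T := T) ρ hρ c₂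
  have hc1r : Continuous fun U => X₁ (reflFT U) := hc1.comp continuous_reflFT
  have hc2r : Continuous fun U => X₂ (reflFT U) := hc2.comp continuous_reflFT
  have hI : ∀ {F : (FinTorusSite S S S T × Fin 4 → G) → ℝ}, Continuous F → Integrable F μH :=
    fun hF => integrable_of_continuous' hF
  -- symmetry facts from reflection invariance
  have hs1 : ∫ U, X₁ (reflFT U) * w U ∂μH = ∫ U, X₁ U * w U ∂μH :=
    integral_reflFT_mul_weight (S := S) (T := T) ρ hρ β X₁
  have hs2 : ∫ U, X₂ (reflFT U) * w U ∂μH = ∫ U, X₂ U * w U ∂μH :=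
    integral_reflFT_mul_weight (S := S) (T := T) ρ hρ β X₂
  have hs12 : ∫ U, X₂ (reflFT U) * X₁ U * w U ∂μH = ∫ U, X₁ (reflFT U) * X₂ U * w U ∂μH := by
    have h := integral_reflFT_mul_weight (S := S) (T := T) ρ hρ β (fun U => X₂ U * X₁ (reflFT U))
    simp only [reflFT_reflFT] at h
    rw [h]
    refine integral_congr_ae (Filter.Eventually.of_forall fun U => ?_)
    show X₂ U * X₁ (reflFT U) * w U = X₁ (reflFT U) * X₂ U * w U
    ring
  -- integrability of all the products (explicit lambda forms)
  have i11 : Integrable (fun U => X₁ (reflFT U) * X₁ U * w U) μH := hI ((hc1r.mul hc1).mul hcw)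
  have i12 : Integrable (fun U => X₁ (reflFT U) * X₂ U * w U) μH := hI ((hc1r.mul hc2).mul hcw)
  have i21 : Integrable (fun U => X₂ (reflFT U) * X₁ U * w U) μH := hI ((hc2r.mul hc1).mul hcw)
  have i22 : Integrable (fun U => X₂ (reflFT U) * X₂ U * w U) μH := hI ((hc2r.mul hc2).mul hcw)
  have i1r : Integrable (fun U => X₁ (reflFT U) * w U) μH := hI (hc1r.mul hcw)
  have i2r : Integrable (fun U => X₂ (reflFT U) * w U) μH := hI (hc2r.mul hcw)
  have i1 : Integrable (fun U => X₁ U * w U) μH := hI (hc1.mul hcw)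
  have i2 : Integrable (fun U => X₂ U * w U) μH := hI (hc2.mul hcw)
  -- expansions
  have e1 : ∫ U, (X₁ (reflFT U) + X₂ (reflFT U)) * (X₁ U + X₂ U) * w U ∂μH =
      (∫ U, X₁ (reflFT U) * X₁ U * w U ∂μH + ∫ U, X₁ (reflFT U) * X₂ U * w U ∂μH) +
      (∫ U, X₂ (reflFT U) * X₁ U * w U ∂μH + ∫ U, X₂ (reflFT U) * X₂ U * w U ∂μH) := by
    have iA : Integrable (fun U => X₁ (reflFT U) * X₁ U * w U + X₁ (reflFT U) * X₂ U * w U) μH := i11.add i12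
    have iB : Integrable (fun U => X₂ (reflFT U) * X₁ U * w U + X₂ (reflFT U) * X₂ U * w U) μH := i21.add i22
    rw [← integral_add i11 i12, ← integral_add i21 i22, ← integral_add iA iB]
    refine integral_congr_ae (Filter.Eventually.of_forall fun U => ?_)
    beta_reduce
    ring
  have e2 : ∫ U, (X₁ (reflFT U) - X₂ (reflFT U)) * (X₁ U - X₂ U) * w U ∂μH =
      (∫ U, X₁ (reflFT U) * X₁ U * w U ∂μH - ∫ U, X₁ (reflFT U) * X₂ U * w U ∂μH) -
      (∫ U, X₂ (reflFT U) * X₁ U * w U ∂μH - ∫ U, X₂ (reflFT U) * X₂ U * w U ∂μH) := by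
    have iA : Integrable (fun U => X₁ (reflFT U) * X₁ U * w U - X₁ (reflFT U) * X₂ U * w U) μH := i11.sub i12
    have iB : Integrable (fun U => X₂ (reflFT U) * X₁ U * w U - X₂ (reflFT U) * X₂ U * w U) μH := i21.sub i22
    rw [← integral_sub i11 i12, ← integral_sub i21 i22, ← integral_sub iA iB]
    refine integral_congr_ae (Filter.Eventually.of_forall fun U => ?_)
    beta_reduce
    ring
  have e3 : ∫ U, (X₁ (reflFT U) + X₂ (reflFT U)) * w U ∂μH =
      ∫ U, X₁ (reflFT U) * w U ∂μH + ∫ U, X₂ (reflFT U) * w U ∂μH := by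
    rw [← integral_add i1r i2r]
    refine integral_congr_ae (Filter.Eventually.of_forall fun U => ?_)
    beta_reduce
    ring
  have e4 : ∫ U, (X₁ (reflFT U) - X₂ (reflFT U)) * w U ∂μH =
      ∫ U, X₁ (reflFT U) * w U ∂μH - ∫ U, X₂ (reflFT U) * w U ∂μH := by
    rw [← integral_sub i1r i2r]
    refine integral_congr_ae (Filter.Eventually.of_forall fun U => ?_)
    beta_reduce
    ring
  have e5 : ∫ U, (X₁ U + X₂ U) * w U ∂μH = ∫ U, X₁ U * w U ∂μH + ∫ U, X₂ U * w U ∂μH := by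
    rw [← integral_add i1 i2]
    refine integral_congr_ae (Filter.Eventually.of_forall fun U => ?_)
    beta_reduce
    ring
  have e6 : ∫ U, (X₁ U - X₂ U) * w U ∂μH = ∫ U, X₁ U * w U ∂μH - ∫ U, X₂ U * w U ∂μH := by
    rw [← integral_sub i1 i2]
    refine integral_congr_ae (Filter.Eventually.of_forall fun U => ?_)
    beta_reduce
    ring
  rw [e1, e2, e3, e4, e5, e6, hs12, hs1, hs2]
  ring

end Summit.QuantumFields.YangMills.Theorems.SqueezedSkewnessCovPolar

end
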